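import Summits.ResolutionOfSingularities.ResolutionOfSingularities.Theorems.PlanarPortFunctor
import HarnessLib

/-!
# PlanarPortFunctor2 — decomp-res node «PlanarPort» (lens-5 g24, critic row 165), tree file 2/3 of the node

Content VERBATIM from the decomp-res lens-5 g24 node `HOME/decomp-res-lens-5/g24/PlanarPort.lean` rev 0 (pin
814caf7a; HOME = run/shared/lean/pub/decomp-res;
critic row 165 CLEARED MAP +1 · DECIDED 0; landing orders INBOX :677) — provenance, critic text and the lens header
in full in the first file of the node,
`PlanarPortFunctor`.  Namespace `…Theorems.PlanarPort`; `--supports stmt-ResolutionOfSingularities-31770`; in the Theses cone.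

## This file

Continuation 2/2 of `PlanarPortFunctor` (cut at the 400-line cap): carries `Kbar`, `ι`, `secState`, `secState_F`,
`secState_r`, `secState_F_ne_zero`, `secState_clean`, `le_ordZero_secState`, `le_degree_of_mem_support_secState`,
`isEquimultiplePoint_secState`, `secState_step_F`, `excLetters_secState_step`, `MaximizingFlagExistsStatement`,
`HP24Prop3`, `HP24Prop4`, `no_strictAnti_triple`, `sm_comm`, `not_monomialLed_zero_of_translated`,
`monomialLed_zero_step_of_untranslated`.

[WRITER NOTE (decomp-res writer g10): file split only (tree files ≤ 400 lines); namespace, sections, section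
variables and every declaration exactly as in
the lens (the lens's global dupNamespace-linter line is dropped — the library sets it).  DEDUP (gate `dedup.landed`,
p803047): the lens's two-line
helper `degree_two` restates the landed Literature theorem
`Literature.RingTheory.MvPolynomial.Ruppert.degree_fin_two` — the copy is dropped and its two use sites
(`degree_secExp'`, `degree_liftExp`) cite the Literature theorem by its full name; import
`Literature/RingTheory/MvPolynomial/RuppertMatrix` added.]

(Sources: HauserPerlega2024 (Publ. RIMS 60; Prop. 3 p. 791, Prop. 4 p. 793, §3 p. 775, §7 p. 788); Perlega2017
(arXiv:2011.14443) §7.3; Hauser2010Kangaroo; BenitoVillamayor2012 §4; KawanoueMatsuki2016 §5; Moh1987; CossartPiltant2008 §2.)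
-/

open MvPolynomial Finset
open Literature.AlgebraicGeometry.Resolution
open Literature.AlgebraicGeometry.Resolution.Hauser2010
open Literature.AlgebraicGeometry.Resolution.HauserPerlega2024
open Literature.AlgebraicGeometry.Resolution.PointBlowup
open Literature.AlgebraicGeometry.Resolution.WeightedBlowup
open Summit.ResolutionOfSingularities.ResolutionOfSingularities.Theses
open Summit.ResolutionOfSingularities.ResolutionOfSingularities.Theorems.TightDefectClasses
open Summit.ResolutionOfSingularities.ResolutionOfSingularities.Theorems.TightDefectStrongWalks
open Summit.ResolutionOfSingularities.ResolutionOfSingularities.Theorems.ItineraryCutClasses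
open Summit.ResolutionOfSingularities.ResolutionOfSingularities.Theorems.ProximityCut
open Summit.ResolutionOfSingularities.ResolutionOfSingularities.Theorems.ExitLaw
open Summit.ResolutionOfSingularities.ResolutionOfSingularities.Theorems.PlanarCut
open Summit.ResolutionOfSingularities.ResolutionOfSingularities.Theorems.CoefficientCut

namespace Summit.ResolutionOfSingularities.ResolutionOfSingularities.Theorems.PlanarPort

section BaseChange

variable {K : Type} [Field K]
variable {i j k : Fin 3} (hij : i ≠ j) (hjk : j ≠ k) (hik : i ≠ k)

/-- an algebraic closure of the (perfect) ground field: Hauser–Perlega work over algebraically closed fields.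
DEFINITION (support). -/
abbrev Kbar (K : Type) [Field K] : Type := AlgebraicClosure K

/-- the embedding `K → K̄`.  DEFINITION (support). -/
noncomputable abbrev ι (K : Type) [Field K] : K →+* Kbar K := algebraMap K (AlgebraicClosure K)

/-- **The section state** of a three-letter walk state along the wall `u_k`: the plane section of `F` base-changed to
`K̄`, with the exceptional multiplicities of the two plane letters (only their SUPPORT — the exceptional letters `E_a` of
[HP24] — is used downstream).  DEFINITION (support). -/
noncomputable def secState (i j k : Fin 3) (s : State (Fin 3) K) : State (Fin 2) (Kbar K) :=
  ⟨MvPolynomial.map (ι K) (res i j k s.F), secExp i j s.r⟩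

omit hij hjk hik in
/-- [folklore] -/
theorem secState_F (s : State (Fin 3) K) : (secState i j k s).F = MvPolynomial.map (ι K) (res i j k s.F) := rfl

omit hij hjk hik in
/-- [folklore] -/
theorem secState_r (s : State (Fin 3) K) : (secState i j k s).r = secExp i j s.r := rfl

include hij hjk hik

/-- The section state is non-zero when the wall layer `0` is non-empty. [folklore] -/
theorem secState_F_ne_zero {s : State (Fin 3) K} (h0 : ∃ d ∈ s.F.support, d k = 0) : (secState i j k s).F ≠ 0 := by
  rw [secState_F, Ne, map_eq_zero_iff _ (map_injective _ (ι K).injective)]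
  exact res_ne_zero_of_layer_zero hij hjk hik h0

/-- … it is cleaned when `F` is. [folklore] -/
theorem secState_clean [DecidableEq K] (q : ℕ) {s : State (Fin 3) K} (hclean : deletePthPowers q s.F = s.F) :
    deletePthPowers q (secState i j k s).F = (secState i j k s).F := by
  classical
  rw [secState_F, ← map_deletePthPowers, ← res_deletePthPowers hij hjk hik, hclean]

/-- … its order is at least that of `F`. [folklore] -/
theorem le_ordZero_secState (s : State (Fin 3) K) : ordZero s.F ≤ ordZero (secState i j k s).F := by
  rw [secState_F, ordZero_map_of_injective (ι K).injective]
  exact le_ordZero_res hij hjk hik s.F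

/-- … its exponents keep the order bound. [folklore] -/
theorem le_degree_of_mem_support_secState {q : ℕ} {s : State (Fin 3) K} (hF : ∀ d ∈ s.F.support, q ≤ d.degree)
    {c : Fin 2 →₀ ℕ} (hc : c ∈ (secState i j k s).F.support) : q ≤ c.degree := by
  rw [secState_F, support_map_of_injective _ (ι K).injective] at hc
  exact le_degree_of_mem_support_res hij hjk hik hF hc

/-- **Equimultiplicity of the section's move (PROVED).** [folklore] -/
theorem isEquimultiplePoint_secState [DecidableEq K] (q : ℕ) {l : Fin 3} (hl : l = i ∨ l = j) (b : Fin 3 → K)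
    (hbl : b l = 0) (hbk : b k = 0) (s : State (Fin 3) K) (hF : ∀ d ∈ s.F.support, q ≤ d.degree)
    (heq : IsEquimultiplePoint q l b s) :
    IsEquimultiplePoint q (idx i l) (ι K ∘ secPt i j b) (secState i j k s) :=
  (PointBlowup.isEquimultiplePoint_map_iff (K' := Kbar K) q (idx i l) (secPt i j b) ⟨res i j k s.F, secExp i j s.r⟩).mpr
    (isEquimultiplePoint_res hij hjk hik q hl b hbl hbk s hF _ heq)

/-- **One planar step of the walk is one step of the section (PROVED, `F`-component):**
`sec(step_{u_l, b} s).F = (step_{X_{idx l}, (b_i,b_j)} (sec s)).F`. [folklore] -/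
theorem secState_step_F [DecidableEq K] [DecidableEq (Kbar K)] (q : ℕ) {l : Fin 3} (hl : l = i ∨ l = j)
    (b : Fin 3 → K) (hbl : b l = 0) (hbk : b k = 0) (s : State (Fin 3) K) (hF : ∀ d ∈ s.F.support, q ≤ d.degree) :
    (secState i j k (step q l b s)).F = (step q (idx i l) (ι K ∘ secPt i j b) (secState i j k s)).F := by
  classical
  show MvPolynomial.map (ι K) (res i j k (deletePthPowers q (translate b (chartTransform q l s.F)))) =
    deletePthPowers q (pointTransform q (idx i l) (ι K ∘ secPt i j b) (secState i j k s))
  rw [res_deletePthPowers hij hjk hik, map_deletePthPowers, res_pointTransform hij hjk hik q hl b hbl hbk s.F hF, secState,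
    PointBlowup.pointTransform_map (K' := Kbar K) q (idx i l) (secPt i j b) ⟨res i j k s.F, secExp i j s.r⟩]
  · rfl

/-- **… and the same exceptional letters (PROVED):** the new exceptional letter is the chart letter on both sides (its
multiplicity `ord − q` is positive on both sides when `q < ord F`), the other plane letter survives iff `b` vanishes on it.
[folklore] -/
theorem excLetters_secState_step [DecidableEq K] [DecidableEq (Kbar K)] (q : ℕ) {l : Fin 3} (hl : l = i ∨ l = j)
    (b : Fin 3 → K) (s : State (Fin 3) K) (hord : ((q : ℕ) : ℕ∞) < ordZero s.F) (h0 : ∃ d ∈ s.F.support, d k = 0) :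
    excLetters (step q (idx i l) (ι K ∘ secPt i j b) (secState i j k s)) = excLetters (secState i j k (step q l b s)) := by
  classical
  have hne : s.F ≠ 0 := by
    obtain ⟨d, hd, -⟩ := h0
    exact MvPolynomial.ne_zero_iff.mpr ⟨d, MvPolynomial.mem_support_iff.mp hd⟩
  have hsecne := secState_F_ne_zero hij hjk hik (s := s) h0
  obtain ⟨o, ho⟩ := exists_ordZero_eq_natCast hne
  obtain ⟨o', ho'⟩ := exists_ordZero_eq_natCast hsecne
  have hqo : q < o := by rw [ho] at hord; exact_mod_cast hord
  have hoo' : o ≤ o' := by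
    have := le_ordZero_secState hij hjk hik s
    rw [ho, ho'] at this
    exact_mod_cast this
  have h1 : (ordZero s.F).toNat - q ≠ 0 := by rw [ho, ENat.toNat_coe]; omega
  have h2 : (ordZero (secState i j k s).F).toNat - q ≠ 0 := by rw [ho', ENat.toNat_coe]; omega
  ext m
  simp only [excLetters, Finsupp.mem_support_iff, step, newMult, secState_r, Finsupp.coe_update, Function.update_apply,
    Finsupp.filter_apply, secExp_apply, Function.comp_apply, secPt, map_eq_zero_iff _ (ι K).injective]
  rcases hl with rfl | rfl
  · fin_cases m <;> simp [idx, h1, h2, hij.symm]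
  · fin_cases m <;> simp [idx, h1, h2, hij, hij.symm]

end BaseChange

section HP

/-! ## §3 Hauser–Perlega 2024 as named propositions; well-founded descent of the flag invariant -/

/-- **[HP24, Prop. 3 p. 791] — existence of a maximizing flag (the existence clause, typed here; NOT asserted).**
"Proposition 3. There exists a maximizing flag `𝓕 ∈ F` with `inv^𝓕_a(X) ∈ ℕ³` and `d_𝓕 > 0`", under the standing local
setting of [HP24] §7 p. 788: "`f = z^{p^e} + F(x, y)` where `ord F > p^e` and the expansion of `F(x, y)` is clean … the
normal crossings divisor `E_a` … `E_a ⊆ V(xy)` … We always assume in the following that `X` is not in a terminal case at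
`a`."  In the tree's dictionary D10 (`Literature/…/PointBlowupFlagInvariant`): for a two-letter state `s` over an
algebraically closed field with `s.F ≠ 0` cleaned of order `> p^e` and `(s.F, E_a = supp s.r)` not terminal up to a
subordinate triangular change, the set of flag values has a greatest element.  Only the EXISTENCE clause is recorded (it is
all the descent below uses; the printed statement adds `inv ∈ ℕ³`, `d > 0`).  A NAMED PROPOSITION, used as a
hypothesis. (Sources: HauserPerlega2024, Prop. 3 p. 791; doi:10.4171/prims/60-4-5.) -/
def MaximizingFlagExistsStatement (p e : ℕ) (L : Type*) [Field L] [CharP L p] [IsAlgClosed L] : Prop :=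
  ∀ s : State (Fin 2) L, s.F ≠ 0 → deletePthPowers (p ^ e) s.F = s.F → ((p ^ e : ℕ) : ℕ∞) < ordZero s.F →
    ¬ IsTerminalSub (p ^ e) (excLetters s) s.F → ∃ v : Triple, IsFlagInvariant (p ^ e) (excLetters s) s.F v

/-- «[HP24] Prop. 3 holds for purely inseparable surfaces of order `p^e`, `e ≥ 1`, over every algebraically closed field of
characteristic `p`» — the hypothesis shape under which the port below is derived.  DEFINITION (support). -/
def HP24Prop3 : Prop :=
  ∀ p : ℕ, p.Prime → ∀ e : ℕ, 1 ≤ e → ∀ (L : Type) [Field L] [CharP L p] [IsAlgClosed L],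
    MaximizingFlagExistsStatement p e L

/-- «[HP24] Prop. 4 (the tree's `HauserPerlega2024.FlagInvariantDropsStatement`, Prop. 4 p. 793) holds over every
algebraically closed field of characteristic `p`».  DEFINITION (support). -/
def HP24Prop4 : Prop :=
  ∀ p : ℕ, p.Prime → ∀ e : ℕ, 1 ≤ e → ∀ (L : Type) [Field L] [CharP L p] [IsAlgClosed L] [DecidableEq L],
    FlagInvariantDropsStatement p e L

/-- The flag invariant takes values in a well-ordered type: no infinite strictly decreasing sequence. [folklore] -/
theorem no_strictAnti_triple (v : ℕ → Triple) (h : ∀ n, v (n + 1) < v n) : False := by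
  obtain ⟨n, hn⟩ := WellFounded.not_rel_apply_succ (r := (· < ·)) v
  exact hn (h n)

end HP

section Law

variable {K : Type} [Field K] [DecidableEq K]

/-! ## §4 THE KERNEL LAW: on a tail of the monomial planar case the wall layer `0` is never monomial-led -/

omit [DecidableEq K] in
/-- The strict multiplicity is symmetric in the two plane letters. [folklore] -/
theorem sm_comm (S : Finset (Fin 3 →₀ ℕ)) (i j : Fin 3) : sm S i j = sm S j i := by
  have h : loSum S i j = loSum S j i := by
    unfold loSum
    have : (fun d : Fin 3 →₀ ℕ => d i + d j) = fun d => d j + d i := funext fun d => add_comm _ _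
    rw [this]
  unfold sm
  rw [h]
  omega

variable {i j k : Fin 3} (hij : i ≠ j) (hjk : j ≠ k) (hik : i ≠ k)
include hij hjk hik

/-- **LAW A, move form (PROVED): no TRANSLATED planar move from a fully monomial-led wall.**  Chart `u_j`, wall `u_k`
kept, translation `u_i ↦ u_i + b_i` with `b_i ≠ 0`, old state cleaned of order `≥ q` with ALL wall layers `0 … q−1`
monomial-led and layer `0` non-empty; then the new point cannot be both equimultiple and isolated.  With `(x₀, y₀)` the
corner of layer `0`: if `x₀ + y₀ ≥ 2q` every new wall-layer-`0` exponent is `u_j`-heavy (`origin_of_mem_layer_step`) and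
with the fat positive layers (`fat_pos_of_dead_pos`) the `u_i`-axis lies in the top locus (`not_isolatedTop_of_fat`);
if `x₀ + y₀ < 2q` the lowest new row is `c₁ · u_j^{x₀+y₀−q} (u_i + b_i)^{x₀}` ALONE, and equimultiplicity kills a
binomial coefficient `C(x₀, 0)` or `C(x₀, x₀)`, unless the corner is a `q`-th power — excluded by cleanliness.
[new] [folklore] -/
theorem not_monomialLed_zero_of_translated (q : ℕ) (b : Fin 3 → K) (hbj : b j = 0) (hbk : b k = 0) (hbi : b i ≠ 0)
    (s : State (Fin 3) K) (hF : ∀ d ∈ s.F.support, q ≤ d.degree)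
    (hF' : ∀ d ∈ (step q j b s).F.support, q ≤ d.degree) (hclean : deletePthPowers q s.F = s.F)
    (hdead : ∀ a, 1 ≤ a → a < q → sm (layer k a s.F) i j = 0) (hne : (layer k 0 s.F).Nonempty)
    (h0 : sm (layer k 0 s.F) i j = 0) (heq : IsEquimultiplePoint q j b s) (hiso : IsolatedTop q (step q j b s).F) :
    False := by
  classical
  obtain ⟨d₁, hd₁, hmin⟩ : ∃ d₁ ∈ layer k 0 s.F, ∀ d' ∈ layer k 0 s.F, d₁ i ≤ d' i ∧ d₁ j ≤ d' j := by
    rcases (sm_eq_zero_iff_isMonomialLed _ i j).mp h0 with h | h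
    · exact absurd h hne.ne_empty
    · exact h
  have hd₁F : d₁ ∈ s.F.support := (Finset.mem_filter.mp hd₁).1
  have hd₁k : d₁ k = 0 := (Finset.mem_filter.mp hd₁).2
  have hc₁ : coeff d₁ s.F ≠ 0 := MvPolynomial.mem_support_iff.mp hd₁F
  have hq0 : q ≤ d₁ i + d₁ j := by
    have h1 := hF d₁ hd₁F
    rw [degree_three hij hjk hik, hd₁k] at h1
    omega
  have hnp : ¬ IsPthPowerExponent q d₁ := by
    intro hp
    have h1 := congrArg (coeff d₁) hclean
    rw [coeff_deletePthPowers, if_pos hp] at h1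
    exact hc₁ h1.symm
  by_cases hbig : 2 * q ≤ d₁ i + d₁ j
  · refine not_isolatedTop_of_fat q i _ (fun d' hd' => ?_) hiso
    rcases Nat.eq_zero_or_pos (d' k) with hk0 | hpos
    · have hmem : d' ∈ layer k 0 (step q j b s).F := mem_layer.mpr ⟨MvPolynomial.mem_support_iff.mp hd', hk0⟩
      obtain ⟨d, hd, hline, -, -⟩ := origin_of_mem_layer_step hij hjk hik q b hbj hbk s hF hmem
      have h1 := hmin d hd
      have hdeg := degree_erase_add d' i
      have h3 := degree_three hij hjk hik d'
      omega
    · exact fat_pos_of_dead_pos hij hjk hik q b hbj hbk hbi s hF hF' hdead d' hd' hpos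
  · push Not at hbig
    have hrow : ∀ l : ℕ, coeff (exp3 i j k l (d₁ i + d₁ j - q) 0) (translate b (chartTransform q j s.F)) =
        coeff d₁ s.F * ((((d₁ i).choose l : ℕ) : K) * b i ^ (d₁ i - l)) := by
      intro l
      rw [coeff_pointTransform_planar hij hjk hik q b hbj hbk s.F hF, Finset.sum_eq_single d₁]
      · rw [exp3_i hij hik]
      · intro d hd hne'
        rw [Finset.mem_filter, exp3_k hjk hik, exp3_j hij hjk] at hd
        obtain ⟨hdF, hdk, hdeg⟩ := hd
        exfalso
        apply hne'
        have h1 := hmin d (Finset.mem_filter.mpr ⟨hdF, hdk⟩)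
        have h3 := degree_three hij hjk hik d
        exact finsupp_ext_three hij hjk hik (by omega) (by omega) (by rw [hdk, hd₁k])
      · intro h
        exfalso
        apply h
        rw [Finset.mem_filter, exp3_k hjk hik, exp3_j hij hjk, degree_three hij hjk hik, hd₁k]
        exact ⟨hd₁F, rfl, by omega⟩
    have hkill : ∀ l : ℕ, 0 < l + (d₁ i + d₁ j - q) → l + (d₁ i + d₁ j - q) < q →
        (((d₁ i).choose l : ℕ) : K) = 0 := by
      intro l h1 h2
      have h := heq (exp3 i j k l (d₁ i + d₁ j - q) 0) ?_ ?_
      · rw [show pointTransform q j b s = translate b (chartTransform q j s.F) from rfl, hrow l] at h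
        rcases mul_eq_zero.mp h with h | h
        · exact absurd h hc₁
        · rcases mul_eq_zero.mp h with h | h
          · exact h
          · exact absurd h (pow_ne_zero _ hbi)
      · intro h0'
        have := congrArg Finsupp.degree h0'
        rw [degree_three hij hjk hik, exp3_i hij hik, exp3_j hij hjk, exp3_k hjk hik, map_zero] at this
        omega
      · rw [degree_three hij hjk hik, exp3_i hij hik, exp3_j hij hjk, exp3_k hjk hik]
        omega
    by_cases hγ : q < d₁ i + d₁ j
    · have h1 := hkill 0 (by omega) (by omega)
      rw [Nat.choose_zero_right, Nat.cast_one] at h1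
      exact one_ne_zero h1
    · have hsum : d₁ i + d₁ j = q := by omega
      by_cases hx : 1 ≤ d₁ i ∧ d₁ i < q
      · have h1 := hkill (d₁ i) (by omega) (by omega)
        rw [Nat.choose_self, Nat.cast_one] at h1
        exact one_ne_zero h1
      · apply hnp
        rw [isPthPowerExponent_iff]
        intro l
        rcases fin3_cases ⟨hij, hjk, hik⟩ l with rfl | rfl | rfl
        · rcases Nat.eq_zero_or_pos (d₁ l) with h | h
          · rw [h]; exact dvd_zero q
          · exact ⟨1, by omega⟩
        · rcases Nat.eq_zero_or_pos (d₁ i) with h | h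
          · exact ⟨1, by omega⟩
          · have : d₁ l = 0 := by omega
            rw [this]; exact dvd_zero q
        · rw [hd₁k]; exact dvd_zero q

/-- **LAW B, move form (PROVED): an UNTRANSLATED planar move keeps the wall layer `0` monomial-led** (the corner goes to
the corner: `(x₀, y₀) ↦ (x₀, x₀ + y₀ − q)`, which is not a `q`-th power because `(x₀, y₀)` is not). [new] [folklore] -/
theorem monomialLed_zero_step_of_untranslated (q : ℕ) (s : State (Fin 3) K) (hF : ∀ d ∈ s.F.support, q ≤ d.degree)
    (hclean : deletePthPowers q s.F = s.F) (h0 : sm (layer k 0 s.F) i j = 0) :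
    sm (layer k 0 (step q j (0 : Fin 3 → K) s).F) i j = 0 := by
  classical
  rcases (sm_eq_zero_iff_isMonomialLed _ i j).mp h0 with hemp | ⟨d₁, hd₁, hmin⟩
  · rw [layer_step_eq_empty hij hjk hik q 0 rfl rfl s hF hemp]
    exact (sm_eq_zero_iff_isMonomialLed _ i j).mpr (Or.inl rfl)
  have hd₁F : d₁ ∈ s.F.support := (Finset.mem_filter.mp hd₁).1
  have hd₁k : d₁ k = 0 := (Finset.mem_filter.mp hd₁).2
  have hc₁ : coeff d₁ s.F ≠ 0 := MvPolynomial.mem_support_iff.mp hd₁F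
  have hq0 : q ≤ d₁ i + d₁ j := by
    have h1 := hF d₁ hd₁F
    rw [degree_three hij hjk hik, hd₁k] at h1
    omega
  have hnp : ¬ IsPthPowerExponent q d₁ := by
    intro hp
    have h1 := congrArg (coeff d₁) hclean
    rw [coeff_deletePthPowers, if_pos hp] at h1
    exact hc₁ h1.symm
  -- the new corner
  have hci : chartExponent q j d₁ i = d₁ i := by rw [chartExponent_apply', if_neg hij]
  have hcj : chartExponent q j d₁ j = d₁ i + d₁ j - q := by
    rw [chartExponent_apply', if_pos rfl, degree_three hij hjk hik, hd₁k, add_zero]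
  have hck : chartExponent q j d₁ k = 0 := by rw [chartExponent_apply', if_neg (Ne.symm hjk), hd₁k]
  have hnp' : ¬ IsPthPowerExponent q (chartExponent q j d₁) := by
    intro hp
    rw [isPthPowerExponent_iff] at hp
    apply hnp
    rw [isPthPowerExponent_iff]
    have hx : q ∣ d₁ i := by have := hp i; rwa [hci] at this
    have hy : q ∣ d₁ i + d₁ j - q := by have := hp j; rwa [hcj] at this
    have hxy : q ∣ d₁ i + d₁ j := by
      have e : d₁ i + d₁ j = (d₁ i + d₁ j - q) + q := by omega
      rw [e]; exact dvd_add hy (dvd_refl q)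
    intro l
    rcases fin3_cases ⟨hij, hjk, hik⟩ l with rfl | rfl | rfl
    · exact hx
    · exact (Nat.dvd_add_iff_right hx).mpr hxy
    · rw [hd₁k]; exact dvd_zero q
  have hmem : chartExponent q j d₁ ∈ layer k 0 (step q j (0 : Fin 3 → K) s).F := by
    rw [mem_layer]
    refine ⟨?_, hck⟩
    show coeff _ (deletePthPowers q (translate 0 (chartTransform q j s.F))) ≠ 0
    rw [coeff_deletePthPowers, if_neg hnp', translate_zero_eq, coeff_chartTransform_chartExponent s.F hF hd₁F]
    exact hc₁
  refine (sm_eq_zero_iff_isMonomialLed _ i j).mpr (Or.inr ⟨_, hmem, fun d' hd' => ?_⟩)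
  obtain ⟨d, hd, hline, -, hfix⟩ := origin_of_mem_layer_step hij hjk hik q 0 rfl rfl s hF hd'
  have h1 := hmin d hd
  have h2 := hfix rfl
  rw [hci, hcj]
  omega

end Law

end Summit.ResolutionOfSingularities.ResolutionOfSingularities.Theorems.PlanarPort
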